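import Summits.Ventures.PercRepro.ProfilePointedCircuitClassesStarNineParB
import Summits.Ventures.PercRepro.ProfilePointedCircuitClassesStarNineOfSeriesPair

/-!
# PercRepro — THE SERIES-PAIR REGIME OF `StarNine` COMPLETED, PART A: A MARKED POINT IN THE PAIR
(p5, gen 57; `proofs/P5-GM1.md` §85)

`starNine_of_seriesPair` (g56) is (★)₉ at `e ≠ f` OUTSIDE a series pair `{b, b′}` through whose second point no
further series pair passes.  The three positions with a marked point IN the pair, at the level `k = 4`:
`{e, f} = {b, b′}` (`starNine_of_seriesPair_self`: the swap gives `in_4(b) = in_4(b′)`), `f` in the pair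
(`starNine_of_seriesPair_right`: §66(c)'s injection `W ↦ W + g` at `k = 4`), `e` in the pair
(`starNine_of_seriesPair_left`: `in_4(b) = P_3` of the minor `N ／ b ∖ b′`, `in_4(f) ≥ 2 · in_3(f)` there, and the
summed (★)₇ gives `out_3(f) ≤ 2 · in_3(f)` on the minor, which is coloop-free when no further series pair passes
through `b′`).
-/

open scoped Matroid

namespace PercRepro.Cogirth

open Finset ThmH Skew Shadow Profile

open Classical

variable {α : Type} [DecidableEq α] {N : Matroid α} [N.Finite]

section StarNineSerA

/-- **(★)₉ ON A SERIES PAIR ITSELF**: `in_4(e) ≤ in_4(f) + thru_4({e, f})` when `{e, f}` is a series pair of a matroid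
with `#E = ρ(E) + 4` — the swap `W ↦ W − e + f` gives `in_4(e) = in_4(f)`. -/
theorem starNine_of_seriesPair_self {e f : α} (hn : (gr N).card = rk N (gr N) + 4) (h : SeriesPair N e f) :
    inCount N 4 e ≤ inCount N 4 f + thruCount N 4 {e, f} := by
  have hswap := card_filter_swap_of_seriesPair h 4 (fun _ => True) (fun _ => Iff.rfl) (fun _ => Iff.rfl)
  have hL : ((biIndepSets N 4).filter (fun W => e ∈ W)).card =
      ((biIndepSets N 4).filter (fun W => (True ∧ e ∈ W) ∧ f ∉ W)).card := by
    apply congrArg Finset.card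
    apply filter_congr
    intro W hW
    constructor
    · intro heW
      exact ⟨⟨trivial, heW⟩, not_mem_of_mem_biIndepSets_of_seriesPair h hn hW heW⟩
    · rintro ⟨⟨-, heW⟩, -⟩
      exact heW
  have hR : ((biIndepSets N 4).filter (fun W => (True ∧ e ∉ W) ∧ f ∈ W)).card ≤
      ((biIndepSets N 4).filter (fun W => f ∈ W)).card := by
    apply card_le_card
    intro W hW
    rw [mem_filter] at hW ⊢
    exact ⟨hW.1, hW.2.2⟩
  unfold inCount
  rw [hL, hswap]
  exact hR.trans (Nat.le_add_right _ _)

/-- **(★)₉ WHEN `f` HAS A SERIES TWIN** (`e` outside the pair): on `#E = 9`, `ρ(E) = 5`,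
`in_4(e) ≤ in_4(f) + thru_4({e, f})` — the sets through `e` avoiding `f, g` inject by `W ↦ W + g` into the
bi-independent `5`-sets through `e` avoiding `f`, i.e. by complementation into the `4`-sets through `f` avoiding `e`. -/
theorem starNine_of_seriesPair_right {e f g : α} (hn : (gr N).card = 9) (hR : rk N (gr N) = 5)
    (h : SeriesPair N f g) (he : e ∈ gr N) (hef : e ≠ f) (heg : e ≠ g) :
    inCount N 4 e ≤ inCount N 4 f + thruCount N 4 {e, f} := by
  have hf : f ∈ gr N := h.1
  have hn4 : (gr N).card = rk N (gr N) + 4 := by omega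
  have hPe : ∀ W : Finset α, e ∈ insert g (W.erase f) ↔ e ∈ W := by
    intro W
    rw [mem_insert, mem_erase]
    constructor
    · rintro (h' | ⟨_, h'⟩)
      · exact absurd h' heg
      · exact h'
    · intro h'
      exact Or.inr ⟨hef, h'⟩
  have hPe' : ∀ W : Finset α, e ∈ insert f (W.erase g) ↔ e ∈ W := by
    intro W
    rw [mem_insert, mem_erase]
    constructor
    · rintro (h' | ⟨_, h'⟩)
      · exact absurd h' hef
      · exact h'
    · intro h'
      exact Or.inr ⟨heg, h'⟩
  have hIg : ∀ W : Finset α, e ∈ insert g W ↔ e ∈ W := by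
    intro W
    rw [mem_insert]
    exact ⟨fun h' => h'.resolve_left heg, fun h' => Or.inr h'⟩
  have hD := card_filter_eq_sum_four (biIndepSets N 4) (fun W => e ∈ W) f g
  have hboth : ((biIndepSets N 4).filter (fun W => (e ∈ W ∧ f ∈ W) ∧ g ∈ W)).card = 0 := by
    rw [card_eq_zero, filter_eq_empty_iff]
    rintro W hW ⟨⟨_, hfW⟩, hgW⟩
    exact not_mem_of_mem_biIndepSets_of_seriesPair h hn4 hW hfW hgW
  have hswap := card_filter_swap_of_seriesPair h 4 (fun W => e ∈ W) hPe hPe'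
  have hinj := card_filter_le_card_filter_insert_of_seriesPair h 4 (fun W => e ∈ W) hIg
  simp only [Nat.reduceAdd] at hinj
  have hcompl := card_filter_sdiff_mixed_eq (M := N) (k := 5) he hf (by omega)
  rw [hn, show (9 : ℕ) - 5 = 4 by norm_num] at hcompl
  have hthru : thruCount N 4 {e, f} = ((biIndepSets N 4).filter (fun W => e ∈ W ∧ f ∈ W)).card := by
    unfold thruCount
    exact congrArg Finset.card (filter_congr (fun W _ => by rw [insert_subset_iff, singleton_subset_iff]))
  have hthru2 := card_filter_eq_sum_two (biIndepSets N 4) (fun W => e ∈ W ∧ f ∈ W) g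
  have hF := card_filter_eq_sum_two (biIndepSets N 4) (fun W => f ∈ W) e
  have hcomm : ((biIndepSets N 4).filter (fun W => f ∈ W ∧ e ∈ W)).card =
      ((biIndepSets N 4).filter (fun W => e ∈ W ∧ f ∈ W)).card :=
    congrArg Finset.card (filter_congr (fun W _ => and_comm))
  have hcomm' : ((biIndepSets N 4).filter (fun W => f ∈ W ∧ e ∉ W)).card =
      ((biIndepSets N 4).filter (fun W => e ∉ W ∧ f ∈ W)).card :=
    congrArg Finset.card (filter_congr (fun W _ => and_comm))
  unfold inCount at hF ⊢
  rw [hD, hboth, hthru, hthru2, hboth, hF, hcomm, hcomm', hthru2, hboth]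
  omega

/-- **(★)₉ WHEN `e` HAS A SERIES TWIN** (`f` outside the pair, no further series pair through the twin `b′`): on a
coloop-free matroid with `#E = 9`, `ρ(E) = 5`, `in_4(b) ≤ in_4(f) + thru_4({b, f})` — `in_4(b) = P_3` of the minor
`N ／ b ∖ b′`, `in_4(f) = 2 · in_3(f) + #{W ∋ f avoiding b, b′}` and `thru_4({b, f}) = in_3(f)` there, and the
summed (★)₇ on the (coloop-free) minor gives `out_3(f) ≤ 2 · in_3(f)`. -/
theorem starNine_of_seriesPair_left (hn : (gr N).card = 9) (hR : rk N (gr N) = 5)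
    (hcf : ∀ x ∈ gr N, rk N ((gr N).erase x) = 5) {b b' f : α} (h : SeriesPair N b b')
    (hno : ∀ x ∈ gr N, x ≠ b → ¬ SeriesPair N b' x) (hf : f ∈ gr N) (hfb : f ≠ b) (hfb' : f ≠ b') :
    inCount N 4 b ≤ inCount N 4 f + thruCount N 4 {b, f} := by
  have hbb' : b ≠ b' := h.2.2.1
  have hn4 : (gr N).card = rk N (gr N) + 4 := by omega
  have hcf' : ∀ x ∈ gr N, rk N ((gr N).erase x) = rk N (gr N) := fun x hx => by rw [hcf x hx, hR]
  -- the seven-point minor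
  have hgr := gr_minor_of_seriesPair (N := N) b b'
  have hn7 : (gr ((N ／ ({b} : Set α)) ＼ ({b'} : Set α))).card = 7 := by
    have := card_gr_minor_add_two_of_seriesPair (N := N) h
    rw [hn] at this; omega
  have hR4 : rk ((N ／ ({b} : Set α)) ＼ ({b'} : Set α)) (gr ((N ／ ({b} : Set α)) ＼ ({b'} : Set α))) = 4 := by
    have := rk_gr_minor_add_one_of_seriesPair (N := N) h
    rw [hR] at this; omega
  have hcf7 : ∀ x ∈ gr ((N ／ ({b} : Set α)) ＼ ({b'} : Set α)),
      rk ((N ／ ({b} : Set α)) ＼ ({b'} : Set α)) ((gr ((N ／ ({b} : Set α)) ＼ ({b'} : Set α))).erase x) = 4 := by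
    intro x hx
    rw [rk_erase_minor_eq_of_seriesPair h hcf' hno x hx, hR4]
  have hdis : Disjoint ((N ／ ({b} : Set α)) ＼ ({b'} : Set α)).E {b, b'} := by
    rw [Set.disjoint_left]
    intro z hz hz'
    have hzg : z ∈ gr ((N ／ ({b} : Set α)) ＼ ({b'} : Set α)) := by rw [← mem_coe, coe_gr]; exact hz
    rw [hgr, mem_erase, mem_erase] at hzg
    rcases hz' with rfl | rfl
    · exact hzg.2.1 rfl
    · exact hzg.1 rfl
  have hfM : f ∈ gr ((N ／ ({b} : Set α)) ＼ ({b'} : Set α)) := by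
    rw [hgr]; exact mem_erase.2 ⟨hfb', mem_erase.2 ⟨hfb, hf⟩⟩
  have hout := outCount_three_le_two_mul_inCount_of_seriesExt hdis hn7 hR4 hcf7 hbb' hfM
  have hP := inCount_add_outCount ((N ／ ({b} : Set α)) ＼ ({b'} : Set α)) 3 f
  -- `in_4(b) = P_3` of the minor
  have hPf : ∀ Y : Finset α, f ∈ insert b Y ↔ f ∈ Y := by
    intro Y
    rw [mem_insert]
    exact ⟨fun h' => h'.resolve_left hfb, fun h' => Or.inr h'⟩
  have hinb : inCount N 4 b = (biIndepSets ((N ／ ({b} : Set α)) ＼ ({b'} : Set α)) 3).card := by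
    have h1 := card_filter_minor_insert_left_eq_of_seriesPair h 3 (fun _ => True) (fun _ => Iff.rfl)
    rw [filter_true_of_mem (fun _ _ => trivial)] at h1
    rw [h1]
    unfold inCount
    apply congrArg Finset.card
    apply filter_congr
    intro W hW
    exact ⟨fun hbW => ⟨⟨trivial, hbW⟩, not_mem_of_mem_biIndepSets_of_seriesPair h hn4 hW hbW⟩,
      fun h' => h'.1.2⟩
  -- `thru_4({b, f}) = in_3(f)` of the minor
  have hthru : thruCount N 4 {b, f} = inCount ((N ／ ({b} : Set α)) ＼ ({b'} : Set α)) 3 f := by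
    have h1 := card_filter_minor_insert_left_eq_of_seriesPair h 3 (fun Y => f ∈ Y) hPf
    unfold inCount thruCount
    rw [h1]
    apply congrArg Finset.card
    apply filter_congr
    intro W hW
    rw [insert_subset_iff, singleton_subset_iff]
    exact ⟨fun h' => ⟨⟨h'.2, h'.1⟩, not_mem_of_mem_biIndepSets_of_seriesPair h hn4 hW h'.1⟩,
      fun h' => ⟨h'.1.2, h'.1.1⟩⟩
  -- `in_4(f) ≥ 2 · in_3(f)` of the minor: the sets through `f, b` and through `f, b′`
  have hPf' : ∀ W : Finset α, f ∈ insert b' (W.erase b) ↔ f ∈ W := by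
    intro W
    rw [mem_insert, mem_erase]
    exact ⟨fun h' => h'.elim (fun h'' => absurd h'' hfb') (fun h'' => h''.2), fun h' => Or.inr ⟨hfb, h'⟩⟩
  have hPf'' : ∀ W : Finset α, f ∈ insert b (W.erase b') ↔ f ∈ W := by
    intro W
    rw [mem_insert, mem_erase]
    exact ⟨fun h' => h'.elim (fun h'' => absurd h'' hfb) (fun h'' => h''.2), fun h' => Or.inr ⟨hfb', h'⟩⟩
  have hswap := card_filter_swap_of_seriesPair h 4 (fun W => f ∈ W) hPf' hPf''
  have hD := card_filter_eq_sum_four (biIndepSets N 4) (fun W => f ∈ W) b b'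
  have hlift := card_filter_minor_insert_left_eq_of_seriesPair h 3 (fun Y => f ∈ Y) hPf
  rw [hinb, hthru]
  unfold inCount at hlift hP hout ⊢
  rw [hD, ← hswap, ← hlift]
  omega

end StarNineSerA

end PercRepro.Cogirth
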